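import Summits.QuantumFields.BalabanUV.T4Continuum.Support.NE7ExpansionSegmentLetters
import HarnessLib

/-!
# NE7CovariantByParts — THE BY-PARTS LETTER AT A CURVED BACKGROUND: the covariant curl `d_W Y` is moved onto a plaquette field `G` at the cost of the
# COVARIANT ADJACENT DIFFERENCES of `G` — `|Σ_{p ∈ perWin d P} Re tr[(d_W Y)(p)·G(p)]∕N| ≤ γ·#Plane·‖Y‖_{ℓ¹(periodBox P)}` — the curved twin of F48a's flat letter, the
# first brick of the STRONG curved expansion letter (hEXP) of F55 (memo `t4/b2b-balaban-t4-ne7-p1-g75/CURVED-APE-ROAD.md` (L5))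

Cell `pub-balaban`, rung (B)+1 sub-cell t4, lineage `b2b-balaban-t4-ne7-p1` (CRUX PROVER NE7 #1 = OWNER of row NE7), generation 75.  File F61, over F48a
`NE7ExpansionSegmentLetters.abs_sum_nReTr_curlAt_flat_mul_le` (the flat letter, by shift invariance) and the trace cyclicity `nReTr_Ad` ∕ `nReTr_mul_comm`.

THE IDENTITY.  With the tree's dressed curl `(d_W Y)(z;μ,ν) = Ad_{U₁}Y(z,μ) + Ad_{U₁U₂}Y(z+e_μ,ν) − Ad_{U₁U₂}Y(z+e_ν,μ) − Ad_{U₁U₂U₃⁻¹}Y(z,ν)` (`U₁ = W(z,μ)`,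
`U₂ = W(z+e_μ,ν)`, `U₃ = W(z+e_ν,μ)`), trace cyclicity `Re tr[Ad_U(A)·B] = Re tr[A·Ad_{U⁻¹}(B)]` and the shift invariance of periodic sums, for every plane `(μ,ν)`:
`Σ_z Re tr[(d_W Y)(z;μ,ν)·G(z)] = Σ_z Re tr[Y(z,μ)·(Ad_{W(z,μ)⁻¹}G(z) − Ad_{(W(z−e_ν,μ)W(z−e_ν+e_μ,ν))⁻¹}G(z−e_ν))]
                               + Σ_z Re tr[Y(z,ν)·(Ad_{(W(z−e_μ,μ)W(z,ν))⁻¹}G(z−e_μ) − Ad_{(W(z,μ)W(z+e_μ,ν)W(z+e_ν,μ)⁻¹)⁻¹}G(z))]`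
— so the curl costs the two COVARIANT adjacent differences of `G` (in direction `ν` seen from the bond `(z,μ)`, in direction `μ` seen from the bond `(z,ν)`), each
transported to the frame of the bond.  At `W = 1` all transports are identities and this is F48a's flat letter.

WHAT ([folklore] lattice calculus; 0 def, 0 sorry; no unitarity or smallness of `W` is used — only invertibility and periodicity).
§1 `nReTr_Ad_mul` (`Re tr[Ad_U(A)·B] = Re tr[A·Ad_{U⁻¹}B]`).
§2 **`abs_sum_nReTr_curlAt_mul_le_W`** — for `P ≥ 1`, `W` `P`-periodic, `Y` `P`-periodic, `G` `P`-periodic with both covariant adjacent differences `≤ γ` on every plane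
   (`γ ≥ 0`): `|Σ_{p ∈ perWin d P} Re tr[(d_W Y)(p)·G(p)]| ≤ γ·#Plane·dirL1 Y (periodBox P)`.
USE (successor, CURVED-APE-ROAD (L5)): with `G := s·𝒬_W(A) = s·dcurlAt W A A` the cubic vertex of the expansion of `hess (We^{sA}) A Y` is moved onto `Y`; the
covariant adjacent differences of `𝒬_W(A)` are `≤ 64α₀α₁ + C·x·α₀²` (curved twin of F46, to be written), giving the STRONG `O(M⁻³)` remainder at a curved `W`.
HONEST FRAMING (page 1): an identity-with-bound on OUR lattice objects; nothing of Bałaban's asserted; (APE) on curved data NOT proved; NOT ONE-STEP, NOT NE7;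
spine 0∕9; finite T⁴ rung (B)+1 — NOT infinite volume, NOT mass gap, NOT `BetaPertH`, NOT Clay.  Continuum YM on T⁴ ⇐ BetaPertH ∧ nine spine estimates (0/9
proved); BetaPertH ⇐ (D1) ∧ (D4) ∧ CAP+tail; G-an2-4 gates asym, D1 and NE2/3/4.
-/

set_option autoImplicit false

open scoped BigOperators Matrix.Norms.L2Operator
open NormedSpace Finset Set

namespace Summit.QuantumFields.BalabanUV.T4Continuum.NE7CovariantByParts

open Literature.MathematicalPhysics.QuantumFieldTheory.Balaban1983to89
open B7Prop1Explicit B7Prop2Explicit MatrixLog UnitaryModel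
open T4AveragingDeficitWall (Ad curlAt dirL1)
open T4AveragingDeficitWallBoundary (IsPeriodicCfg periodBox sum_periodBox_shift)
open AveragingDeficitPeriodicCounting (IsPeriodicDir)
open AveragingDeficitNearIdentity (abs_nReTr_mul_le nReTr_Ad)
open AveragingDeficitDualResidual (pair_le_sum)
open MinimalActionLevels (perWin)
open NE3HessBounds (nReTr_mul_comm)

noncomputable section

variable {d : ℕ} {n : Type*} [Fintype n] [DecidableEq n]

/-! ## §1 Trace cyclicity through a transport -/

/-- `Re tr[Ad_U(A)·B] = Re tr[A·Ad_{U⁻¹}(B)]`. [folklore] -/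
theorem nReTr_Ad_mul (u : (Matrix n n ℂ)ˣ) (A B : Matrix n n ℂ) : nReTr (Ad u A * B) = nReTr (A * Ad u⁻¹ B) := by
  have h : Ad u A * B = Ad u (A * Ad u⁻¹ B) := by
    simp only [Ad, inv_inv, ← mul_assoc, Units.mul_inv_cancel_right]
  rw [h, nReTr_Ad]

/-! ## §2 The by-parts letter at a curved background -/

/-- **THE BY-PARTS LETTER AT A CURVED BACKGROUND** (statement and identity in the module docstring). [folklore] -/
theorem abs_sum_nReTr_curlAt_mul_le_W {P : ℕ} (hP : 1 ≤ P) {W : Site d → Fin d → (Matrix n n ℂ)ˣ} (hWP : IsPeriodicCfg W (P : ℤ))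
    {Y : Site d → Fin d → Matrix n n ℂ} (hYP : IsPeriodicDir Y (P : ℤ))
    {G : Site d → Fin d → Fin d → Matrix n n ℂ} (hGP : ∀ (z : Site d) (κ μ ν : Fin d), G (z + (P : ℤ) • e κ) μ ν = G z μ ν) {γ : ℝ} (hγ : 0 ≤ γ)
    (hG₁ : ∀ (π : T4AveragingDeficitWall.Plane d) (z : Site d),
      ‖Ad (W z π.1.1)⁻¹ (G z π.1.1 π.1.2)
          - Ad (W (z - e π.1.2) π.1.1 * W (z - e π.1.2 + e π.1.1) π.1.2)⁻¹ (G (z - e π.1.2) π.1.1 π.1.2)‖ ≤ γ)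
    (hG₂ : ∀ (π : T4AveragingDeficitWall.Plane d) (z : Site d),
      ‖Ad (W (z - e π.1.1) π.1.1 * W z π.1.2)⁻¹ (G (z - e π.1.1) π.1.1 π.1.2)
          - Ad (W z π.1.1 * W (z + e π.1.1) π.1.2 * (W (z + e π.1.2) π.1.1)⁻¹)⁻¹ (G z π.1.1 π.1.2)‖ ≤ γ) :
    |∑ p ∈ perWin d P, nReTr (curlAt W Y p.1 p.2.1.1 p.2.1.2 * G p.1 p.2.1.1 p.2.1.2)|
      ≤ γ * (Fintype.card (T4AveragingDeficitWall.Plane d) : ℝ) * dirL1 Y (periodBox (d := d) P) := by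
  unfold perWin T4AveragingDeficitWall.dirL1
  rw [Finset.sum_product, Finset.sum_comm]
  have hf0 : ∀ i, 0 ≤ ∑ z ∈ periodBox (d := d) P, ‖Y z i‖ := fun i => Finset.sum_nonneg fun _ _ => norm_nonneg _
  -- one plane
  have hplane : ∀ π : T4AveragingDeficitWall.Plane d,
      |∑ z ∈ periodBox (d := d) P, nReTr (curlAt W Y z π.1.1 π.1.2 * G z π.1.1 π.1.2)|
        ≤ γ * (∑ z ∈ periodBox (d := d) P, ‖Y z π.1.1‖ + ∑ z ∈ periodBox (d := d) P, ‖Y z π.1.2‖) := by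
    intro π
    set μ := π.1.1 with hμ
    set ν := π.1.2 with hν
    -- expand the dressed curl, move every transport onto `G`, split the trace
    have hsplit : ∀ z : Site d, nReTr (curlAt W Y z μ ν * G z μ ν)
        = nReTr (Y z μ * Ad (W z μ)⁻¹ (G z μ ν))
          + nReTr (Y (z + e μ) ν * Ad (W z μ * W (z + e μ) ν)⁻¹ (G z μ ν))
          - nReTr (Y (z + e ν) μ * Ad (W z μ * W (z + e μ) ν)⁻¹ (G z μ ν))
          - nReTr (Y z ν * Ad (W z μ * W (z + e μ) ν * (W (z + e ν) μ)⁻¹)⁻¹ (G z μ ν)) := by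
      intro z
      simp only [curlAt, sub_mul, add_mul, T4TiltOscillation.nReTr_sub, T4TiltOscillation.nReTr_add, nReTr_Ad_mul]
    simp only [hsplit, Finset.sum_sub_distrib, Finset.sum_add_distrib]
    -- shift the two forward terms back onto `G`
    have hs1 : ∑ z ∈ periodBox (d := d) P, nReTr (Y (z + e μ) ν * Ad (W z μ * W (z + e μ) ν)⁻¹ (G z μ ν))
        = ∑ z ∈ periodBox (d := d) P, nReTr (Y z ν * Ad (W (z - e μ) μ * W z ν)⁻¹ (G (z - e μ) μ ν)) := by
      have h := sum_periodBox_shift P hP (g := fun z => nReTr (Y z ν * Ad (W (z - e μ) μ * W z ν)⁻¹ (G (z - e μ) μ ν))) (fun x κ => by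
        show nReTr (Y (x + (P : ℤ) • e κ) ν * Ad (W (x + (P : ℤ) • e κ - e μ) μ * W (x + (P : ℤ) • e κ) ν)⁻¹ (G (x + (P : ℤ) • e κ - e μ) μ ν))
          = nReTr (Y x ν * Ad (W (x - e μ) μ * W x ν)⁻¹ (G (x - e μ) μ ν))
        rw [hYP x κ ν, hWP x κ ν, add_sub_right_comm, hGP, hWP]) (e μ)
      simp only [add_sub_cancel_right] at h
      exact h
    have hs2 : ∑ z ∈ periodBox (d := d) P, nReTr (Y (z + e ν) μ * Ad (W z μ * W (z + e μ) ν)⁻¹ (G z μ ν))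
        = ∑ z ∈ periodBox (d := d) P, nReTr (Y z μ * Ad (W (z - e ν) μ * W (z - e ν + e μ) ν)⁻¹ (G (z - e ν) μ ν)) := by
      have h := sum_periodBox_shift P hP (g := fun z => nReTr (Y z μ * Ad (W (z - e ν) μ * W (z - e ν + e μ) ν)⁻¹ (G (z - e ν) μ ν))) (fun x κ => by
        show nReTr (Y (x + (P : ℤ) • e κ) μ * Ad (W (x + (P : ℤ) • e κ - e ν) μ * W (x + (P : ℤ) • e κ - e ν + e μ) ν)⁻¹ (G (x + (P : ℤ) • e κ - e ν) μ ν))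
          = nReTr (Y x μ * Ad (W (x - e ν) μ * W (x - e ν + e μ) ν)⁻¹ (G (x - e ν) μ ν))
        rw [hYP x κ μ, add_sub_right_comm, hGP, hWP, show x - e ν + (P : ℤ) • e κ + e μ = (x - e ν + e μ) + (P : ℤ) • e κ by abel, hWP]) (e ν)
      simp only [add_sub_cancel_right] at h
      rw [h]
    rw [hs1, hs2]
    -- regroup bond by bond
    have hre : ∑ z ∈ periodBox (d := d) P, nReTr (Y z μ * Ad (W z μ)⁻¹ (G z μ ν))
          + ∑ z ∈ periodBox (d := d) P, nReTr (Y z ν * Ad (W (z - e μ) μ * W z ν)⁻¹ (G (z - e μ) μ ν))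
          - ∑ z ∈ periodBox (d := d) P, nReTr (Y z μ * Ad (W (z - e ν) μ * W (z - e ν + e μ) ν)⁻¹ (G (z - e ν) μ ν))
          - ∑ z ∈ periodBox (d := d) P, nReTr (Y z ν * Ad (W z μ * W (z + e μ) ν * (W (z + e ν) μ)⁻¹)⁻¹ (G z μ ν))
        = ∑ z ∈ periodBox (d := d) P,
          (nReTr (Y z μ * (Ad (W z μ)⁻¹ (G z μ ν) - Ad (W (z - e ν) μ * W (z - e ν + e μ) ν)⁻¹ (G (z - e ν) μ ν)))
            + nReTr (Y z ν * (Ad (W (z - e μ) μ * W z ν)⁻¹ (G (z - e μ) μ ν)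
                - Ad (W z μ * W (z + e μ) ν * (W (z + e ν) μ)⁻¹)⁻¹ (G z μ ν)))) := by
      simp only [mul_sub, T4TiltOscillation.nReTr_sub, Finset.sum_add_distrib, Finset.sum_sub_distrib]
      ring
    rw [hre]
    refine (Finset.abs_sum_le_sum_abs _ _).trans ?_
    have hbd : ∀ z ∈ periodBox (d := d) P,
        |nReTr (Y z μ * (Ad (W z μ)⁻¹ (G z μ ν) - Ad (W (z - e ν) μ * W (z - e ν + e μ) ν)⁻¹ (G (z - e ν) μ ν)))
            + nReTr (Y z ν * (Ad (W (z - e μ) μ * W z ν)⁻¹ (G (z - e μ) μ ν)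
                - Ad (W z μ * W (z + e μ) ν * (W (z + e ν) μ)⁻¹)⁻¹ (G z μ ν)))| ≤ γ * ‖Y z μ‖ + γ * ‖Y z ν‖ := by
      intro z _
      have h1 := abs_nReTr_mul_le (Y z μ) (Ad (W z μ)⁻¹ (G z μ ν) - Ad (W (z - e ν) μ * W (z - e ν + e μ) ν)⁻¹ (G (z - e ν) μ ν))
      have h2 := abs_nReTr_mul_le (Y z ν) (Ad (W (z - e μ) μ * W z ν)⁻¹ (G (z - e μ) μ ν)
        - Ad (W z μ * W (z + e μ) ν * (W (z + e ν) μ)⁻¹)⁻¹ (G z μ ν))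
      have e1 := mul_le_mul_of_nonneg_left (hG₁ π z) (norm_nonneg (Y z μ))
      have e2 := mul_le_mul_of_nonneg_left (hG₂ π z) (norm_nonneg (Y z ν))
      have := abs_add_le (nReTr (Y z μ * (Ad (W z μ)⁻¹ (G z μ ν) - Ad (W (z - e ν) μ * W (z - e ν + e μ) ν)⁻¹ (G (z - e ν) μ ν))))
        (nReTr (Y z ν * (Ad (W (z - e μ) μ * W z ν)⁻¹ (G (z - e μ) μ ν) - Ad (W z μ * W (z + e μ) ν * (W (z + e ν) μ)⁻¹)⁻¹ (G z μ ν))))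
      linarith
    refine (Finset.sum_le_sum hbd).trans (le_of_eq ?_)
    rw [Finset.sum_add_distrib, ← Finset.mul_sum, ← Finset.mul_sum]
    ring
  -- sum over planes
  refine (Finset.abs_sum_le_sum_abs _ _).trans ?_
  calc ∑ π : T4AveragingDeficitWall.Plane d, |∑ z ∈ periodBox (d := d) P, nReTr (curlAt W Y z π.1.1 π.1.2 * G z π.1.1 π.1.2)|
      ≤ ∑ π : T4AveragingDeficitWall.Plane d, γ * (∑ z ∈ periodBox (d := d) P, ‖Y z π.1.1‖ + ∑ z ∈ periodBox (d := d) P, ‖Y z π.1.2‖) :=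
        Finset.sum_le_sum fun π _ => hplane π
    _ ≤ ∑ _π : T4AveragingDeficitWall.Plane d, γ * ∑ i, ∑ z ∈ periodBox (d := d) P, ‖Y z i‖ :=
        Finset.sum_le_sum fun π _ =>
          mul_le_mul_of_nonneg_left (pair_le_sum (f := fun i => ∑ z ∈ periodBox (d := d) P, ‖Y z i‖) hf0 π) hγ
    _ = γ * (Fintype.card (T4AveragingDeficitWall.Plane d) : ℝ) * ∑ z ∈ periodBox (d := d) P, ∑ κ, ‖Y z κ‖ := by
        rw [Finset.sum_const, Finset.card_univ, nsmul_eq_mul, Finset.sum_comm]; ring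

end

end Summit.QuantumFields.BalabanUV.T4Continuum.NE7CovariantByParts
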